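import Literature.IUT.HodgeTheaters.GlobalFrobenioidsCyclotomesNumberFieldModel
import Literature.NumberTheory.GaloisRepresentations.GaloisCohomologyKummerProofs
import HarnessLib

/-!
# [IUTchI] Example 5.1 (v), p. 128, second display — `UniqueCyclotomeIsoFamily` at the genuine Kummer
# container of a number field OVER THE CANONICAL LEVELS (all open subgroups of `Γ_k`): hypothesis-free form

S. Mochizuki, *Inter-universal Teichmüller theory I*, kurims manuscript (May 2020), §5 Example 5.1 (v), p. 128
l. 25–49 [claim: Mochizuki2012, status: disputed]: "there exists a unique isomorphism of cyclotomes
`μ^Θ_Ẑ(π₁(†𝒟^⊚)) ⥲ μ_Ẑ(†𝕄^⊛)` such that the resulting isomorphism between direct limits of cohomology modules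
[`lim_{→ H} H¹(H, ·)`, "where `H` ranges over the open subgroups", p. 127] induces isomorphisms
`𝕄^⊛(†𝒟^⊚) ⥲ †𝕄^⊛`, `𝕄^⊛_sol(†𝒟^⊚) ⥲ †𝕄^⊛_sol`, `𝕄^⊛_mod(†𝒟^⊚) ⥲ †𝕄^⊛_mod` … compatible with the integral
submonoids `𝒪^⊿_𝔭`".  Container / Kummer map: LANA Project interim report [LANA2026Report], §6.1 pp. 31–32
(hypothesis (c) there: "`M = ⋃_H M^H`").

Cell abc-iut; PROOF-ONLY corollary file (theorems only: no `def`, no `instance`, no `structure`, no new `Prop`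
fact) of abc-iut-w4-d035's `GlobalFrobenioidsCyclotomesNumberFieldModel.lean` (p439050:
`uniqueCyclotomeIsoFamily_numberFieldModel`, `uniqueCyclotomeIsoFamily_numberField_astLayer`), node
IUTchI:Ex5.1(v), sub-DAG row E51/L28.  That file proves the display at the Kummer container
`lim_{→ i} H¹(S i, Λ(k̄ˣ))` of a number field `k` for ANY directed system `S` of subgroups of `Γ_k` under two
hypotheses on `S`: (c) exhaustion `hc : IsExhausted k̄ˣ S` and `hfin` (every `S i` contains `Gal(k̄/L_i)` for a
finite `L_i/k`).  **This file discharges both at print's own index system — ALL OPEN SUBGROUPS of `Γ_k`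
(ordered by reverse inclusion):** `isExhausted_units_openSubgroup` (the stabiliser of a unit of `k̄` is open:
abc-iut's `isLocallyConstant_smul_units`, i.e. smoothness of the discrete `Γ_k`-module `k̄ˣ`) and
`exists_finite_fixingSubgroup_le_openSubgroup` (open subgroups contain some `Gal(k̄/L)`, `L/k` finite:
`exists_finite_fixingSubgroup_le_of_isOpen`, abc-iut-w4-d057), whence the HYPOTHESIS-FREE forms
`uniqueCyclotomeIsoFamily_numberField_canonical` (source cyclotome any abstract `μ` with its chosen
identification `e₀ : μ ⥲ Λ(k̄ˣ)` = the [AbsTopIII] Thm 1.9 (d) datum; layers `⊛ ↦ κ(k̄ˣ)`, `sol ↦ κ(Fˣ)`,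
`mod ↦ κ(kˣ)` for an intermediate field `F`; integral submonoids `κ(𝒪^⊿_𝔭)` for every finite prime `𝔭` of `k`;
the `e₀ = id` instance `μ := Λ(k̄ˣ)` is abc-iut-w4-d035's `AstLayer` family verbatim).  §3 is the CERTIFICATE FORM
`uniqueCyclotomeIsoFamily_numberField_canonical_of_etale_laws`: Frobenioid side and container genuine, étale side an
interface under exactly two laws (E) [the [AbsTopIII] Thm 1.9 (d)(e) input] and (T) [functoriality of the étale-side
realisation]; §4 `etale_laws_numberField_astLayer_canonical` shows the pair (E)(T) is jointly satisfiable at the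
genuine model (non-vacuity; inhabited ≠ discharged).

HONEST FRAMING: classical infinite Galois theory / Kummer theory of number fields and `Ẑ`-bookkeeping, OUR kernel
check.  As in the parent file, the étale-side cyclotome and container are MODELLED by an abstract cyclotome
identified with `Λ(k̄ˣ)` along a chosen `e₀` (existence = [AbsTopIII] Thm 1.9 (d), FACT-policy, a DATUM here, not
proved), and the equivariance clause "[of monoids equipped with continuous actions by `π₁(†𝒟^⊛)`]" is not part of
the record.  Nothing here asserts a statement of the disputed series or takes a side on [IUTchIII] Cor. 3.12;
typed ≠ proved.  Universe `Type` (Mathlib `groupCohomology`), as in the Kummer files; the index type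
`(OpenSubgroup Γ_k)ᵒᵈ` has no decidable equality, so the statements open the `Classical` scope.
-/

noncomputable section

open CategoryTheory groupCohomology ProfiniteGrp ProfiniteGrp.ProfiniteCompletion NumberField IsDedekindDomain
open Literature.AnabelianGeometry.EtaleTheta Literature.AnabelianGeometry.EtaleTheta.ZHatLevel

namespace Literature.IUT.HodgeTheaters

variable (k : Type) [Field k] [NumberField k]

/-! ## §1 The canonical level system of `Γ_k`: all open subgroups, by reverse inclusion -/

omit [NumberField k] in
/-- The open subgroups of `Γ_k = Gal(k̄/k)`, indexed by reverse inclusion, form an antitone family of subgroups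
(the transition maps of "`lim_{→ H} H¹(H, ·)`, `H` ranging over the open subgroups", [IUTchI] Ex. 5.1 (v) p. 127;
[cite: LANA2026Report, §6.1 p. 31]). -/
theorem absoluteGaloisGroup_openSubgroup_antitone :
    ∀ ⦃i j : (OpenSubgroup (Field.absoluteGaloisGroup k))ᵒᵈ⦄, i ≤ j →
      ((OrderDual.ofDual j : OpenSubgroup (Field.absoluteGaloisGroup k)) :
          Subgroup (Field.absoluteGaloisGroup k)) ≤
        ((OrderDual.ofDual i : OpenSubgroup (Field.absoluteGaloisGroup k)) :
          Subgroup (Field.absoluteGaloisGroup k)) :=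
  fun _ _ hij _ hx => OrderDual.ofDual_le_ofDual.mpr hij hx

omit [NumberField k] in
/-- **EXHAUSTION over the canonical levels** (hypothesis (c) "`M = ⋃_H M^H`" of [cite: LANA2026Report, §6.1 p. 31]
for `M = k̄ˣ`, `H` ranging over the open subgroups of `Γ_k`): every unit of `k̄` is fixed by some open subgroup of
`Γ_k` — its stabiliser, which is open because the orbit map `σ ↦ σ • a` is locally constant (smoothness of the
discrete `Γ_k`-module `k̄ˣ`). [cite: NeukirchANT1999, Ch. IV §1] -/
theorem isExhausted_units_openSubgroup :
    IsExhausted (AlgebraicClosure k)ˣ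
      (fun i : (OpenSubgroup (Field.absoluteGaloisGroup k))ᵒᵈ =>
        ((OrderDual.ofDual i : OpenSubgroup (Field.absoluteGaloisGroup k)) :
          Subgroup (Field.absoluteGaloisGroup k))) := by
  intro a
  have hopen : IsOpen {σ : Field.absoluteGaloisGroup k | σ • a = a} :=
    (Literature.NumberTheory.GaloisRepresentations.isLocallyConstant_smul_units k a).isOpen_fiber a
  refine ⟨OrderDual.toDual ⟨MulAction.stabilizer (Field.absoluteGaloisGroup k) a, hopen⟩, fun γ => ?_⟩
  exact MulAction.mem_stabilizer_iff.mp γ.2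

omit [NumberField k] in
/-- **Open subgroups are of finite level**: every open subgroup of `Γ_k` contains `Gal(k̄/L)` for some finite
extension `L/k` (the `Gal(k̄/L)`, `L/k` finite, form a neighbourhood basis of `1` in the Krull topology) — the
hypothesis `hfin` of `uniqueCyclotomeIsoFamily_numberFieldModel` at the canonical levels.
[cite: NeukirchANT1999, Ch. IV §1] -/
theorem exists_finite_fixingSubgroup_le_openSubgroup (i : (OpenSubgroup (Field.absoluteGaloisGroup k))ᵒᵈ) :
    ∃ L : IntermediateField k (AlgebraicClosure k), FiniteDimensional k L ∧
      ∀ σ : Field.absoluteGaloisGroup k, Field.absoluteGaloisGroup.toAlgEquiv k σ ∈ L.fixingSubgroup →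
        σ ∈ ((OrderDual.ofDual i : OpenSubgroup (Field.absoluteGaloisGroup k)) :
          Subgroup (Field.absoluteGaloisGroup k)) :=
  exists_finite_fixingSubgroup_le_of_isOpen k _ (OrderDual.ofDual i).isOpen

/-! ## §2 Ex. 5.1 (v), second display, at the genuine container over the canonical levels — hypothesis-free -/

open scoped Classical in
/-- **[IUTchI] Ex. 5.1 (v), p. 128, second display — `UniqueCyclotomeIsoFamily` at the genuine Kummer container
`lim_{→ H} H¹(H, Λ(k̄ˣ))` of the number field `k` [`F_mod`], `H` RANGING OVER ALL OPEN SUBGROUPS of `Γ_k` (print's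
index system, p. 127), with NO hypothesis.**  Family (as `uniqueCyclotomeIsoFamily_numberFieldModel`, abc-iut-w4-d035):
source cyclotome any abstract `μ` with its chosen identification `e₀ : μ ⥲ Λ(k̄ˣ)` [[AbsTopIII] Thm 1.9 (d) — a
DATUM, not proved], target `Λ(k̄ˣ) = μ_Ẑ(†𝕄^⊛)`, both containers the genuine `lim_{→ H} H¹(H, Λ(k̄ˣ))`, layers
`⊛ ↦ κ(k̄ˣ)`, `sol ↦ κ(Fˣ)` (`F/k` an intermediate field of `k̄/k`), `mod ↦ κ(kˣ)`, integral submonoids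
`κ({x ∈ kˣ : v_𝔭(x) ≤ 1})` for EVERY finite prime `𝔭`, induced map of `e` = the container twist by the cyclotomic
parameter of `e ∘ e₀⁻¹ ∈ Aut(Λ(k̄ˣ)) = Ẑ^×`.  Conclusion: there is EXACTLY ONE isomorphism of cyclotomes satisfying the
display's such-that clause (namely `e₀`).  The two system hypotheses of the parent theorem are THEOREMS here:
exhaustion (`isExhausted_units_openSubgroup`) and finite level (`exists_finite_fixingSubgroup_le_openSubgroup`).
[cite: Mochizuki2012, IUTchI Ex. 5.1 (v) p. 128] [claim: Mochizuki2012, status: disputed]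
[cite: LANA2026Report, §6.1 pp. 31–32] -/
theorem uniqueCyclotomeIsoFamily_numberField_canonical (μ : Type) [CommGroup μ]
    (e₀ : μ ≃* cyclotome (AlgebraicClosure k)ˣ) (F : IntermediateField k (AlgebraicClosure k)) :
    UniqueCyclotomeIsoFamily
      ({ μ₁ := μ, μ₂ := cyclotome (AlgebraicClosure k)ˣ,
          H₁ := H1Colimit (AlgebraicClosure k)ˣ
            (fun i : (OpenSubgroup (Field.absoluteGaloisGroup k))ᵒᵈ =>
              ((OrderDual.ofDual i : OpenSubgroup (Field.absoluteGaloisGroup k)) :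
                Subgroup (Field.absoluteGaloisGroup k)))
            (absoluteGaloisGroup_openSubgroup_antitone k),
          H₂ := H1Colimit (AlgebraicClosure k)ˣ
            (fun i : (OpenSubgroup (Field.absoluteGaloisGroup k))ᵒᵈ =>
              ((OrderDual.ofDual i : OpenSubgroup (Field.absoluteGaloisGroup k)) :
                Subgroup (Field.absoluteGaloisGroup k)))
            (absoluteGaloisGroup_openSubgroup_antitone k),
          im₁ := fun i : AstLayer => match i with
            | .ast => Set.range (kummerMap (absoluteGaloisGroup_openSubgroup_antitone k)
                (isExhausted_units_openSubgroup k))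
            | .sol => Set.range fun x : Fˣ =>
                kummerMap (absoluteGaloisGroup_openSubgroup_antitone k) (isExhausted_units_openSubgroup k)
                  (Units.map (algebraMap F (AlgebraicClosure k) : F →* AlgebraicClosure k) x)
            | .mod => Set.range fun x : kˣ =>
                kummerMap (absoluteGaloisGroup_openSubgroup_antitone k) (isExhausted_units_openSubgroup k)
                  (Units.map (algebraMap k (AlgebraicClosure k) : k →* AlgebraicClosure k) x),
          im₂ := fun i : AstLayer => match i with
            | .ast => Set.range (kummerMap (absoluteGaloisGroup_openSubgroup_antitone k)
                (isExhausted_units_openSubgroup k))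
            | .sol => Set.range fun x : Fˣ =>
                kummerMap (absoluteGaloisGroup_openSubgroup_antitone k) (isExhausted_units_openSubgroup k)
                  (Units.map (algebraMap F (AlgebraicClosure k) : F →* AlgebraicClosure k) x)
            | .mod => Set.range fun x : kˣ =>
                kummerMap (absoluteGaloisGroup_openSubgroup_antitone k) (isExhausted_units_openSubgroup k)
                  (Units.map (algebraMap k (AlgebraicClosure k) : k →* AlgebraicClosure k) x),
          int₁ := fun 𝔭 : HeightOneSpectrum (𝓞 k) => (fun x : kˣ =>
              kummerMap (absoluteGaloisGroup_openSubgroup_antitone k) (isExhausted_units_openSubgroup k)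
                (Units.map (algebraMap k (AlgebraicClosure k) : k →* AlgebraicClosure k) x)) ''
            {x : kˣ | 𝔭.valuation k (x : k) ≤ 1},
          int₂ := fun 𝔭 : HeightOneSpectrum (𝓞 k) => (fun x : kˣ =>
              kummerMap (absoluteGaloisGroup_openSubgroup_antitone k) (isExhausted_units_openSubgroup k)
                (Units.map (algebraMap k (AlgebraicClosure k) : k →* AlgebraicClosure k) x)) ''
            {x : kˣ | 𝔭.valuation k (x : k) ≤ 1},
          induced := fun e' h => H1ColimTwist
            (fun i : (OpenSubgroup (Field.absoluteGaloisGroup k))ᵒᵈ =>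
              ((OrderDual.ofDual i : OpenSubgroup (Field.absoluteGaloisGroup k)) :
                Subgroup (Field.absoluteGaloisGroup k)))
            (absoluteGaloisGroup_openSubgroup_antitone k)
            ((MulEquiv.ofBijective (cyclotome.zhatTwist (AlgebraicClosure k)ˣ)
              (cyclotome.zhatTwist_bijective_of_isSepClosed (AlgebraicClosure k))).symm (e₀.symm.trans e')) h } :
        CyclotomeComparisonFamily AstLayer (HeightOneSpectrum (𝓞 k))) :=
  uniqueCyclotomeIsoFamily_numberFieldModel k _ (absoluteGaloisGroup_openSubgroup_antitone k)
    (isExhausted_units_openSubgroup k) (exists_finite_fixingSubgroup_le_openSubgroup k) μ e₀ _ AstLayer.mod rfl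

/-! ## §3 The HALF-GENUINE family: Frobenioid side + container genuine, étale side an interface with two laws -/

open scoped Classical in
/-- **[IUTchI] Ex. 5.1 (v), p. 128, second display with the FROBENIOID SIDE AND THE CONTAINER GENUINE and the
ÉTALE SIDE AN INTERFACE** (the certificate form).  Target cyclotome `μ_Ẑ(†𝕄^⊛) = Λ(k̄ˣ)` [`†𝕄^⊛ = 𝒪^×` of the
number field side, Ex. 5.1 (iv) p. 126 l. 19–38], target container the GENUINE `lim_{→ H} H¹(H, Λ(k̄ˣ))` over ALL
open subgroups `H` of `Γ_k` (p. 127), Frobenius-like layers `L` with `L i₀ = κ(kˣ)` [`†𝕄^⊛_mod = F_mod^×`] and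
integral submonoids `κ(𝒪^⊿_𝔭)` for every finite prime `𝔭` of `k`; the `Ẑ^×`-torsor structure on isomorphisms of
cyclotomes `zμ u e := (twist by u) ∘ e` [`Aut(Λ(k̄ˣ)) = Ẑ^×` on the nose, `cyclotome.zhatTwist_bijective_of_isSepClosed`]
and the container action `H1ColimTwist` are the genuine ones.  The étale-like side — the cyclotome
`μ^Θ_Ẑ(π₁(†𝒟^⊚)) =: μ₁`, the container `H₁`, the sub-objects `𝕄^⊛_•(†𝒟^⊚) =: im₁`, `int₁` and the map `induced e`
"between direct limits of cohomology modules" induced by an isomorphism of cyclotomes `e` ([AbsTopIII] Thm 1.9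
(d)(e), FACT-policy) — is abstract DATA subject to exactly TWO laws: (E) `hE` = the printed existence claim "there
exists a[n] isomorphism of cyclotomes … such that the resulting isomorphism … induces isomorphisms … compatible with
the integral submonoids" [the [AbsTopIII] Thm 1.9 (d)(e) input], and (T) `hT` = functoriality of the étale-side
realisation under the `Ẑ^×`-twist (`induced (twist u ∘ e) = (twist u) ∘ induced e`).  CONCLUSION:
`UniqueCyclotomeIsoFamily` — the isomorphism of (E) is UNIQUE.  The remaining three hypotheses (V)(I)(P) and the
torsor unit law of the closer of record `UniqueCyclotomeIsoFamily.of_integral_laws` (abc-iut-w4-d057, p427568) are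
THEOREMS here: (V)(I)(P) = `exists_valuation_laws_numberField` (abc-iut-w4-d035) at the canonical levels (§1), unit
law = `map_one`; the torsor half of (T) (`e′ = zμ u e` for the parameter `u` of `e′ ∘ e⁻¹`) is `Aut(Λ(k̄ˣ)) = Ẑ^×`.
[cite: Mochizuki2012, IUTchI Ex. 5.1 (v) p. 128] [claim: Mochizuki2012, status: disputed]
[cite: LANA2026Report, §6.1 pp. 31–32] -/
theorem uniqueCyclotomeIsoFamily_numberField_canonical_of_etale_laws
    (μ₁ : Type) [CommGroup μ₁] (H₁ : Type) {ι : Type} (im₁ : ι → Set H₁)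
    (int₁ : HeightOneSpectrum (𝓞 k) → Set H₁)
    (induced : (μ₁ ≃* cyclotome (AlgebraicClosure k)ˣ) → H₁ →
      H1Colimit (AlgebraicClosure k)ˣ
        (fun i : (OpenSubgroup (Field.absoluteGaloisGroup k))ᵒᵈ =>
          ((OrderDual.ofDual i : OpenSubgroup (Field.absoluteGaloisGroup k)) :
            Subgroup (Field.absoluteGaloisGroup k)))
        (absoluteGaloisGroup_openSubgroup_antitone k))
    (L : ι → Set (H1Colimit (AlgebraicClosure k)ˣ
        (fun i : (OpenSubgroup (Field.absoluteGaloisGroup k))ᵒᵈ =>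
          ((OrderDual.ofDual i : OpenSubgroup (Field.absoluteGaloisGroup k)) :
            Subgroup (Field.absoluteGaloisGroup k)))
        (absoluteGaloisGroup_openSubgroup_antitone k))) (i₀ : ι)
    (hL : L i₀ = Set.range fun x : kˣ =>
      kummerMap (absoluteGaloisGroup_openSubgroup_antitone k) (isExhausted_units_openSubgroup k)
        (Units.map (algebraMap k (AlgebraicClosure k) : k →* AlgebraicClosure k) x))
    -- LAW (E): [AbsTopIII] Thm 1.9 (d)(e) — some isomorphism of cyclotomes induces compatible isomorphisms
    (hE : ∃ e₀ : μ₁ ≃* cyclotome (AlgebraicClosure k)ˣ,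
      ({ μ₁ := μ₁, μ₂ := cyclotome (AlgebraicClosure k)ˣ, H₁ := H₁,
          H₂ := H1Colimit (AlgebraicClosure k)ˣ
            (fun i : (OpenSubgroup (Field.absoluteGaloisGroup k))ᵒᵈ =>
              ((OrderDual.ofDual i : OpenSubgroup (Field.absoluteGaloisGroup k)) :
                Subgroup (Field.absoluteGaloisGroup k)))
            (absoluteGaloisGroup_openSubgroup_antitone k),
          im₁ := im₁, im₂ := L, int₁ := int₁,
          int₂ := fun 𝔭 : HeightOneSpectrum (𝓞 k) => (fun x : kˣ =>
              kummerMap (absoluteGaloisGroup_openSubgroup_antitone k) (isExhausted_units_openSubgroup k)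
                (Units.map (algebraMap k (AlgebraicClosure k) : k →* AlgebraicClosure k) x)) ''
            {x : kˣ | 𝔭.valuation k (x : k) ≤ 1},
          induced := induced } :
        CyclotomeComparisonFamily ι (HeightOneSpectrum (𝓞 k))).InducesCompatibleIsos e₀)
    -- LAW (T): functoriality of the étale-side realisation under the `Ẑ^×`-twist of the coefficients
    (hT : ∀ (e : μ₁ ≃* cyclotome (AlgebraicClosure k)ˣ) (u : MulAut (completion (GrpCat.of (Multiplicative ℤ))))
      (h : H₁), induced (e.trans (cyclotome.zhatTwist (AlgebraicClosure k)ˣ u)) h =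
        H1ColimTwist
          (fun i : (OpenSubgroup (Field.absoluteGaloisGroup k))ᵒᵈ =>
            ((OrderDual.ofDual i : OpenSubgroup (Field.absoluteGaloisGroup k)) :
              Subgroup (Field.absoluteGaloisGroup k)))
          (absoluteGaloisGroup_openSubgroup_antitone k) u (induced e h)) :
    UniqueCyclotomeIsoFamily
      ({ μ₁ := μ₁, μ₂ := cyclotome (AlgebraicClosure k)ˣ, H₁ := H₁,
          H₂ := H1Colimit (AlgebraicClosure k)ˣ
            (fun i : (OpenSubgroup (Field.absoluteGaloisGroup k))ᵒᵈ =>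
              ((OrderDual.ofDual i : OpenSubgroup (Field.absoluteGaloisGroup k)) :
                Subgroup (Field.absoluteGaloisGroup k)))
            (absoluteGaloisGroup_openSubgroup_antitone k),
          im₁ := im₁, im₂ := L, int₁ := int₁,
          int₂ := fun 𝔭 : HeightOneSpectrum (𝓞 k) => (fun x : kˣ =>
              kummerMap (absoluteGaloisGroup_openSubgroup_antitone k) (isExhausted_units_openSubgroup k)
                (Units.map (algebraMap k (AlgebraicClosure k) : k →* AlgebraicClosure k) x)) ''
            {x : kˣ | 𝔭.valuation k (x : k) ≤ 1},
          induced := induced } :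
        CyclotomeComparisonFamily ι (HeightOneSpectrum (𝓞 k))) := by
  obtain ⟨val, -, hV, hI, hP⟩ := exists_valuation_laws_numberField k _
    (absoluteGaloisGroup_openSubgroup_antitone k) (isExhausted_units_openSubgroup k)
    (exists_finite_fixingSubgroup_le_openSubgroup k)
  -- (V)(I)(P) at the layer `L i₀ = κ(kˣ)`
  have hval : ∀ u : MulAut (completion (GrpCat.of (Multiplicative ℤ))),
      Set.MapsTo (H1ColimTwist _ (absoluteGaloisGroup_openSubgroup_antitone k) u) (L i₀) (L i₀) →
        ∀ h ∈ L i₀, ∀ 𝔭 : HeightOneSpectrum (𝓞 k),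
          u (eta (val 𝔭 h)) = eta (val 𝔭 (H1ColimTwist _ (absoluteGaloisGroup_openSubgroup_antitone k) u h)) := by
    rw [hL]; exact hV
  have hint : ∀ 𝔭 : HeightOneSpectrum (𝓞 k), ∀ h ∈ L i₀, h ∈ (fun x : kˣ =>
      kummerMap (absoluteGaloisGroup_openSubgroup_antitone k) (isExhausted_units_openSubgroup k)
        (Units.map (algebraMap k (AlgebraicClosure k) : k →* AlgebraicClosure k) x)) ''
          {x : kˣ | 𝔭.valuation k (x : k) ≤ 1} → 0 ≤ val 𝔭 h := by
    rw [hL]; exact hI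
  have hpos : ∃ 𝔭₀ : HeightOneSpectrum (𝓞 k), ∃ h ∈ L i₀, h ∈ (fun x : kˣ =>
      kummerMap (absoluteGaloisGroup_openSubgroup_antitone k) (isExhausted_units_openSubgroup k)
        (Units.map (algebraMap k (AlgebraicClosure k) : k →* AlgebraicClosure k) x)) ''
          {x : kˣ | 𝔭₀.valuation k (x : k) ≤ 1} ∧ 0 < val 𝔭₀ h := by
    rw [hL]; exact hP
  -- the torsor half of (T): `Aut(Λ(k̄ˣ)) = Ẑ^×`, so `e' = (twist by u) ∘ e` for the parameter `u` of `e' ∘ e⁻¹`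
  have htors : ∀ e e' : μ₁ ≃* cyclotome (AlgebraicClosure k)ˣ,
      ∃ u : MulAut (completion (GrpCat.of (Multiplicative ℤ))),
        e' = e.trans (cyclotome.zhatTwist (AlgebraicClosure k)ˣ u) ∧
          ∀ h, induced e' h =
            H1ColimTwist _ (absoluteGaloisGroup_openSubgroup_antitone k) u (induced e h) := by
    intro e e'
    have happ : ∀ y : MulAut (cyclotome (AlgebraicClosure k)ˣ), cyclotome.zhatTwist (AlgebraicClosure k)ˣ
        ((MulEquiv.ofBijective (cyclotome.zhatTwist (AlgebraicClosure k)ˣ)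
          (cyclotome.zhatTwist_bijective_of_isSepClosed (AlgebraicClosure k))).symm y) = y := fun y =>
      (MulEquiv.ofBijective (cyclotome.zhatTwist (AlgebraicClosure k)ˣ)
        (cyclotome.zhatTwist_bijective_of_isSepClosed (AlgebraicClosure k))).apply_symm_apply y
    have heq : e' = e.trans (cyclotome.zhatTwist (AlgebraicClosure k)ˣ
        ((MulEquiv.ofBijective (cyclotome.zhatTwist (AlgebraicClosure k)ˣ)
          (cyclotome.zhatTwist_bijective_of_isSepClosed (AlgebraicClosure k))).symm (e.symm.trans e'))) := by
      rw [happ]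
      exact MulEquiv.ext fun x => by
        rw [MulEquiv.trans_apply, MulEquiv.trans_apply, MulEquiv.symm_apply_apply]
    refine ⟨_, heq, fun h => ?_⟩
    have hh := hT e ((MulEquiv.ofBijective (cyclotome.zhatTwist (AlgebraicClosure k)ˣ)
      (cyclotome.zhatTwist_bijective_of_isSepClosed (AlgebraicClosure k))).symm (e.symm.trans e')) h
    rw [← heq] at hh
    exact hh
  exact UniqueCyclotomeIsoFamily.of_integral_laws _ i₀
    (fun u e => e.trans (cyclotome.zhatTwist (AlgebraicClosure k)ˣ u)) (fun e => by rw [map_one]; rfl)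
    (fun u h => H1ColimTwist _ (absoluteGaloisGroup_openSubgroup_antitone k) u h) hE htors val hval hint hpos

/-! ## §4 NON-VACUITY of the two étale laws: they hold at the genuine number-field model (étale side := Frobenioid side) -/

open scoped Classical in
/-- **Non-vacuity of the binder pair (E)(T) of `uniqueCyclotomeIsoFamily_numberField_canonical_of_etale_laws`**: at
abc-iut-w4-d035's genuine number-field model over the canonical levels — étale side := the Frobenioid side itself
(`μ₁ := Λ(k̄ˣ)`, `H₁ :=` the genuine container, `im₁ := im₂`, `int₁ := int₂`, `induced e :=` the container twist by the
cyclotomic parameter of `e`) — law (E) holds with `e₀ = id` and law (T) holds (multiplicativity of the parameter and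
functoriality `H1ColimTwist_mul_apply`).  So the two laws are JOINTLY SATISFIABLE at genuine data (inhabited ≠
discharged: the étale side of print is the [AbsTopIII] Thm 1.9 output, not this model).
[cite: Mochizuki2012, IUTchI Ex. 5.1 (v) p. 128] [claim: Mochizuki2012, status: disputed]
[cite: LANA2026Report, §6.1 pp. 31–32] -/
theorem etale_laws_numberField_astLayer_canonical (F : IntermediateField k (AlgebraicClosure k)) :
    (∃ e₀ : cyclotome (AlgebraicClosure k)ˣ ≃* cyclotome (AlgebraicClosure k)ˣ,
      ({ μ₁ := cyclotome (AlgebraicClosure k)ˣ, μ₂ := cyclotome (AlgebraicClosure k)ˣ,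
          H₁ := H1Colimit (AlgebraicClosure k)ˣ
            (fun i : (OpenSubgroup (Field.absoluteGaloisGroup k))ᵒᵈ =>
              ((OrderDual.ofDual i : OpenSubgroup (Field.absoluteGaloisGroup k)) :
                Subgroup (Field.absoluteGaloisGroup k)))
            (absoluteGaloisGroup_openSubgroup_antitone k),
          H₂ := H1Colimit (AlgebraicClosure k)ˣ
            (fun i : (OpenSubgroup (Field.absoluteGaloisGroup k))ᵒᵈ =>
              ((OrderDual.ofDual i : OpenSubgroup (Field.absoluteGaloisGroup k)) :
                Subgroup (Field.absoluteGaloisGroup k)))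
            (absoluteGaloisGroup_openSubgroup_antitone k),
          im₁ := fun i : AstLayer => match i with
            | .ast => Set.range (kummerMap (absoluteGaloisGroup_openSubgroup_antitone k)
                (isExhausted_units_openSubgroup k))
            | .sol => Set.range fun x : Fˣ =>
                kummerMap (absoluteGaloisGroup_openSubgroup_antitone k) (isExhausted_units_openSubgroup k)
                  (Units.map (algebraMap F (AlgebraicClosure k) : F →* AlgebraicClosure k) x)
            | .mod => Set.range fun x : kˣ =>
                kummerMap (absoluteGaloisGroup_openSubgroup_antitone k) (isExhausted_units_openSubgroup k)
                  (Units.map (algebraMap k (AlgebraicClosure k) : k →* AlgebraicClosure k) x),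
          im₂ := fun i : AstLayer => match i with
            | .ast => Set.range (kummerMap (absoluteGaloisGroup_openSubgroup_antitone k)
                (isExhausted_units_openSubgroup k))
            | .sol => Set.range fun x : Fˣ =>
                kummerMap (absoluteGaloisGroup_openSubgroup_antitone k) (isExhausted_units_openSubgroup k)
                  (Units.map (algebraMap F (AlgebraicClosure k) : F →* AlgebraicClosure k) x)
            | .mod => Set.range fun x : kˣ =>
                kummerMap (absoluteGaloisGroup_openSubgroup_antitone k) (isExhausted_units_openSubgroup k)
                  (Units.map (algebraMap k (AlgebraicClosure k) : k →* AlgebraicClosure k) x),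
          int₁ := fun 𝔭 : HeightOneSpectrum (𝓞 k) => (fun x : kˣ =>
              kummerMap (absoluteGaloisGroup_openSubgroup_antitone k) (isExhausted_units_openSubgroup k)
                (Units.map (algebraMap k (AlgebraicClosure k) : k →* AlgebraicClosure k) x)) ''
            {x : kˣ | 𝔭.valuation k (x : k) ≤ 1},
          int₂ := fun 𝔭 : HeightOneSpectrum (𝓞 k) => (fun x : kˣ =>
              kummerMap (absoluteGaloisGroup_openSubgroup_antitone k) (isExhausted_units_openSubgroup k)
                (Units.map (algebraMap k (AlgebraicClosure k) : k →* AlgebraicClosure k) x)) ''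
            {x : kˣ | 𝔭.valuation k (x : k) ≤ 1},
          induced := fun e' h => H1ColimTwist
            (fun i : (OpenSubgroup (Field.absoluteGaloisGroup k))ᵒᵈ =>
              ((OrderDual.ofDual i : OpenSubgroup (Field.absoluteGaloisGroup k)) :
                Subgroup (Field.absoluteGaloisGroup k)))
            (absoluteGaloisGroup_openSubgroup_antitone k)
            ((MulEquiv.ofBijective (cyclotome.zhatTwist (AlgebraicClosure k)ˣ)
              (cyclotome.zhatTwist_bijective_of_isSepClosed (AlgebraicClosure k))).symm
                ((MulEquiv.refl (cyclotome (AlgebraicClosure k)ˣ)).symm.trans e')) h } :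
        CyclotomeComparisonFamily AstLayer (HeightOneSpectrum (𝓞 k))).InducesCompatibleIsos e₀) ∧
    (∀ (e : cyclotome (AlgebraicClosure k)ˣ ≃* cyclotome (AlgebraicClosure k)ˣ)
      (u : MulAut (completion (GrpCat.of (Multiplicative ℤ))))
      (h : H1Colimit (AlgebraicClosure k)ˣ
        (fun i : (OpenSubgroup (Field.absoluteGaloisGroup k))ᵒᵈ =>
          ((OrderDual.ofDual i : OpenSubgroup (Field.absoluteGaloisGroup k)) :
            Subgroup (Field.absoluteGaloisGroup k)))
        (absoluteGaloisGroup_openSubgroup_antitone k)),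
      H1ColimTwist
          (fun i : (OpenSubgroup (Field.absoluteGaloisGroup k))ᵒᵈ =>
            ((OrderDual.ofDual i : OpenSubgroup (Field.absoluteGaloisGroup k)) :
              Subgroup (Field.absoluteGaloisGroup k)))
          (absoluteGaloisGroup_openSubgroup_antitone k)
          ((MulEquiv.ofBijective (cyclotome.zhatTwist (AlgebraicClosure k)ˣ)
            (cyclotome.zhatTwist_bijective_of_isSepClosed (AlgebraicClosure k))).symm
              ((MulEquiv.refl (cyclotome (AlgebraicClosure k)ˣ)).symm.trans
                (e.trans (cyclotome.zhatTwist (AlgebraicClosure k)ˣ u)))) h =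
        H1ColimTwist
          (fun i : (OpenSubgroup (Field.absoluteGaloisGroup k))ᵒᵈ =>
            ((OrderDual.ofDual i : OpenSubgroup (Field.absoluteGaloisGroup k)) :
              Subgroup (Field.absoluteGaloisGroup k)))
          (absoluteGaloisGroup_openSubgroup_antitone k) u
          (H1ColimTwist
            (fun i : (OpenSubgroup (Field.absoluteGaloisGroup k))ᵒᵈ =>
              ((OrderDual.ofDual i : OpenSubgroup (Field.absoluteGaloisGroup k)) :
                Subgroup (Field.absoluteGaloisGroup k)))
            (absoluteGaloisGroup_openSubgroup_antitone k)
            ((MulEquiv.ofBijective (cyclotome.zhatTwist (AlgebraicClosure k)ˣ)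
              (cyclotome.zhatTwist_bijective_of_isSepClosed (AlgebraicClosure k))).symm
                ((MulEquiv.refl (cyclotome (AlgebraicClosure k)ˣ)).symm.trans e)) h)) := by
  refine ⟨(uniqueCyclotomeIsoFamily_numberField_canonical k _ (MulEquiv.refl _) F).existsUnique.exists,
    fun e u h => ?_⟩
  -- the parameter is multiplicative: `param ((twist u) ∘ e) = u * param e`, and `H1ColimTwist` is an action
  have hmul : (MulEquiv.refl (cyclotome (AlgebraicClosure k)ˣ)).symm.trans
      (e.trans (cyclotome.zhatTwist (AlgebraicClosure k)ˣ u)) =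
        cyclotome.zhatTwist (AlgebraicClosure k)ˣ u *
          (MulEquiv.refl (cyclotome (AlgebraicClosure k)ˣ)).symm.trans e :=
    MulEquiv.ext fun x => rfl
  have hparam : (MulEquiv.ofBijective (cyclotome.zhatTwist (AlgebraicClosure k)ˣ)
      (cyclotome.zhatTwist_bijective_of_isSepClosed (AlgebraicClosure k))).symm
        (cyclotome.zhatTwist (AlgebraicClosure k)ˣ u) = u :=
    (MulEquiv.ofBijective (cyclotome.zhatTwist (AlgebraicClosure k)ˣ)
      (cyclotome.zhatTwist_bijective_of_isSepClosed (AlgebraicClosure k))).symm_apply_apply u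
  rw [hmul, map_mul, hparam, H1ColimTwist_mul_apply]

end Literature.IUT.HodgeTheaters
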